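import Mathlib
import Summits.Ventures.PercRepro2.TypedTwoEdgesAtO
import Summits.Ventures.PercRepro2.TypedClassReopen
import Summits.Ventures.PercRepro2.TypedClassCountAPI

/-!
# Two typed edges at `o`, III: the double-attachment class in the class-sum vocabulary
(blind cell PercRepro2, night-3 g16, 2026-08-27)

With the class sums of TypedBasesStar.lean (`typedClassCount`) and their re-opened form
(TypedClassReopen.lean): for two typed edges `e, f` of type `1`, the three SAME-COLOUR classes of the
star `{e, f}` (both edges carried by copy `1`, `2`, `3`) are the three terms of `doubleClass`
(`typedClassCount_pair_copy1/2/3`, `doubleClass_eq_sum_classes`); the same-colour class of the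
SYMMETRISED kernel is a third of the double class (`typedClassCount_symKer_pair`, from
`typedClassCount_symKer`); hence, at a mark `o` of typed degree two (both edges of type `1`, the
other edges at `o` pinned closed), the (TRI-o)-type class sums of `symKer K₃` at the colourings
of the `o`-star are: the six mixed ones `= (N(F ∖ e) + N(F ∖ f)) / 3` — not stated here — and the
three same-colour ones `= (N − 2N(F ∖ e) − 2N(F ∖ f)) / 3`; **`same_class_nonneg_iff`**: the
same-colour class of `symKer K₃` is nonnegative iff `2N(F ∖ e) + 2N(F ∖ f) ≤ N` — the statement
NEG-191 refutes at `|F| = 9` (night-3 g15 §24.9; typer-1 g45's kernel witness p525990) is exactly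
the failure of this superadditivity.  Own work; standard axioms.
-/

namespace Summit.Ventures.PercRepro2

namespace CovForm

namespace TypedRed

open OneTyped

section Classes

variable {E : Type*} [Fintype E] [DecidableEq E] {R : Type*} [Field R]

/-- The colouring opening exactly the edges `e` and `f`. -/
def pairCol (e f : E) : Config E := fun e' => decide (e' = e ∨ e' = f)

/-- The all-closed colouring. -/
def zeroCol : Config E := fun _ => false

omit [Fintype E] in
/-- `pairCol e f` opens `e`. -/
@[simp] lemma pairCol_left (e f : E) : pairCol e f e = true := by simp [pairCol]
omit [Fintype E] in
/-- `pairCol e f` opens `f`. -/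
@[simp] lemma pairCol_right (e f : E) : pairCol e f f = true := by simp [pairCol]
omit [Fintype E] [DecidableEq E] in
/-- `zeroCol` is closed everywhere. -/
@[simp] lemma zeroCol_apply (e : E) : (zeroCol : Config E) e = false := rfl

/-- The class with both edges in copy `1` is the first term of `doubleClass`. -/
theorem typedClassCount_pair_copy1 (F : Finset E) (e f : E) (he : e ∈ F) (hf : f ∈ F)
    (hef : e ≠ f) (z : Config E) (τ : E → ℕ) (hτe : τ e = 1) (hτf : τ f = 1)
    (K : Config E → Config E → Config E → R) :
    typedClassCount F z τ {e, f} (pairCol e f) zeroCol zeroCol K =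
      term F z τ e f K true true false false false false := by
  rw [typedClassCount_pair_eq F e f he hf hef, if_pos (by simp [hτe, hτf])]
  simp only [term, upd2, pairCol_left, pairCol_right, zeroCol_apply]

/-- The class with both edges in copy `2` is the second term of `doubleClass`. -/
theorem typedClassCount_pair_copy2 (F : Finset E) (e f : E) (he : e ∈ F) (hf : f ∈ F)
    (hef : e ≠ f) (z : Config E) (τ : E → ℕ) (hτe : τ e = 1) (hτf : τ f = 1)
    (K : Config E → Config E → Config E → R) :
    typedClassCount F z τ {e, f} zeroCol (pairCol e f) zeroCol K =
      term F z τ e f K false false true true false false := by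
  rw [typedClassCount_pair_eq F e f he hf hef, if_pos (by simp [hτe, hτf])]
  simp only [term, upd2, pairCol_left, pairCol_right, zeroCol_apply]

/-- The class with both edges in copy `3` is the third term of `doubleClass`. -/
theorem typedClassCount_pair_copy3 (F : Finset E) (e f : E) (he : e ∈ F) (hf : f ∈ F)
    (hef : e ≠ f) (z : Config E) (τ : E → ℕ) (hτe : τ e = 1) (hτf : τ f = 1)
    (K : Config E → Config E → Config E → R) :
    typedClassCount F z τ {e, f} zeroCol zeroCol (pairCol e f) K =
      term F z τ e f K false false false false true true := by
  rw [typedClassCount_pair_eq F e f he hf hef, if_pos (by simp [hτe, hτf])]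
  simp only [term, upd2, pairCol_left, pairCol_right, zeroCol_apply]

/-- **`doubleClass` is the sum of the three same-colour classes of the star `{e, f}`.** -/
theorem doubleClass_eq_sum_classes (F : Finset E) (e f : E) (he : e ∈ F) (hf : f ∈ F)
    (hef : e ≠ f) (z : Config E) (τ : E → ℕ) (hτe : τ e = 1) (hτf : τ f = 1)
    (K : Config E → Config E → Config E → R) :
    doubleClass F z τ e f K =
      typedClassCount F z τ {e, f} (pairCol e f) zeroCol zeroCol K +
        typedClassCount F z τ {e, f} zeroCol (pairCol e f) zeroCol K +
        typedClassCount F z τ {e, f} zeroCol zeroCol (pairCol e f) K := by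
  rw [typedClassCount_pair_copy1 F e f he hf hef z τ hτe hτf,
    typedClassCount_pair_copy2 F e f he hf hef z τ hτe hτf,
    typedClassCount_pair_copy3 F e f he hf hef z τ hτe hτf]
  rfl

/-- **The same-colour class of the symmetrised kernel is a third of the double class.** -/
theorem typedClassCount_symKer_pair [CharZero R] (F : Finset E) (e f : E) (he : e ∈ F)
    (hf : f ∈ F) (hef : e ≠ f) (z : Config E) (τ : E → ℕ) (hτe : τ e = 1) (hτf : τ f = 1)
    (K : Config E → Config E → Config E → R) :
    typedClassCount F z τ {e, f} (pairCol e f) zeroCol zeroCol (symKer K) =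
      (3 : R)⁻¹ * doubleClass F z τ e f K := by
  rw [typedClassCount_symKer, doubleClass_eq_sum_classes F e f he hf hef z τ hτe hτf]
  have h6 : (6 : R) ≠ 0 := by norm_num
  have h3 : (3 : R) ≠ 0 := by norm_num
  field_simp
  ring

end Classes

/-! ## At a mark `o` of typed degree two -/

section AtO

open Classical

variable {V : Type*} {E : Type*} [Fintype E] [DecidableEq E] {R : Type*} [Field R]
  [LinearOrder R] [IsStrictOrderedRing R]

variable (ends : E → Sym2 V) (o a₁ a₂ a₃ b : V)

/-- **The same-colour `o`-class of `symKer K₃` is nonnegative iff the typed count is superadditive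
at `o`**: for `e = {o, u}`, `f = {o, v}` of type `1` and every other edge at `o` pinned closed,
`0 ≤ class(both in copy 1) ↔ 2 N_τ(F ∖ e) + 2 N_τ(F ∖ f) ≤ N_τ`. -/
theorem same_class_nonneg_iff {e f : E} {u v : V} (he : ends e = s(o, u))
    (hf : ends f = s(o, v)) (hou : o ≠ u) (hov : o ≠ v) (hef : e ≠ f) (ho1 : o ≠ a₁) (ho2 : o ≠ a₂)
    (ho3 : o ≠ a₃) (hob : o ≠ b) (F : Finset E) (heF : e ∈ F) (hfF : f ∈ F) (z : Config E)
    (τ : E → ℕ) (hτe : τ e = 1) (hτf : τ f = 1)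
    (hcl : ∀ e', e' ≠ e → e' ≠ f → o ∈ ends e' → e' ∉ F ∧ z e' = false) :
    0 ≤ typedClassCount F z τ {e, f} (pairCol e f) zeroCol zeroCol
        (symKer (K3 ends o a₁ a₂ a₃ b : Config E → Config E → Config E → R)) ↔
      2 * typedCount (F.erase e) (Function.update z e false) τ (K3 ends o a₁ a₂ a₃ b) +
        2 * typedCount (F.erase f) (Function.update z f false) τ (K3 ends o a₁ a₂ a₃ b) ≤
        typedCount F z τ (K3 ends o a₁ a₂ a₃ b : Config E → Config E → Config E → R) := by
  rw [typedClassCount_symKer_pair F e f heF hfF hef z τ hτe hτf,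
    ← doubleClass_nonneg_iff (R := R) ends o a₁ a₂ a₃ b he hf hou hov hef ho1 ho2 ho3 hob F heF hfF
      z τ hτe hτf hcl]
  constructor
  · intro h
    have h3 : (0 : R) < (3 : R)⁻¹ := by norm_num
    exact nonneg_of_mul_nonneg_right (by simpa [mul_comm] using h) h3
  · intro h
    exact mul_nonneg (by norm_num) h

end AtO

end TypedRed

end CovForm

end Summit.Ventures.PercRepro2
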